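/-
Copyright (c) 2026 the pub-hodgecm-mathlib formalisation cell (harness21).  Prover seat hodgecm-mathlib-F0P3a-p01 (g16): road «S3-ram» (LEAD F0P3a-plan (g12); architect
A-p16 (g31) 23:11:46Z «(C1′) FIRST, then (B)»), organ A′ (ii) (a2) part (C1′, isoceles): the ROOT REGION splits off the isolated eigenline; 2026-09-01.
-/
import Literature.NumberTheory.Automorphic.UnitaryLatticeTreeSeparableStableRoot   -- ★ p847156 (this seat): `smul_sub_mem_of_map_diagonal_le` (one Lagrange step), `le_stdLattice_of_coord_of_le_dualLatt`
import Literature.NumberTheory.Automorphic.UnitaryLatticeTreeApartment             -- ★ (B-p14): `dualLatt_eq_self_of_isSelfDualLattice`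
import HarnessLib

/-!
# The lattice graph of a hermitian space — a diagonal endomorphism with ONE ISOLATED residue splits every stable self-dual lattice as `𝒪e_i ⊕ (binary part)`
# (Bruhat–Tits 1972 §10; Kottwitz 1986 §3; Serre, *Trees* II.1.1)

Topic `NumberTheory/Automorphic`; namespace `Literature.NumberTheory.Automorphic.UnitaryLatticeTree`.  THEOREMS ONLY (no definition, no instance, no notation, no named fact,
no `sorry`); kernel lane `--supports stmt-HodgeConjecture-24833`; datum-free (`K` with `Valued K ℤᵐ⁰`, `σ` valuation-preserving).  Cell `pub/hodgecm-mathlib` (D-0151), crux H413;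
road «S3-ram» (count-neutral), P-1-ram organ A′ (ii) (a2) «SHELL SUMS», part (C1′) of the root-bookkeeping design `F0/P3a/F0P3a-p01/g16/rootbook/DESIGN-a2C-RootBookkeeping.v1…md`
§2–§3 (the ISOCELES configurations `N₁ = N₂ < N`, `N₁ < N = N₂`, …): when exactly ONE residue of the top-level semisimple `S = π^{−d₀}(t−1) = diag(s)` is isolated (`|s_i − s_j| = 1`
for the two `j ≠ i`, the other two residues possibly equal — A-p16's «AXIS» rows (3,3,5), (3,5,3), (3,3,7)), the root region `R = {S-stable self-dual vertices}` is NOT `{L₀}`; this file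
shows what it is: every such `M` SPLITS as `M = 𝒪e_i ⊕ (M ∩ W_i)`, `W_i = {x : x_i = 0}`, with `M ∩ W_i` SELF-DUAL RELATIVE TO `W_i` and `diag(s)`-stable — i.e. `R ≅` the
`diag(s)`-stable self-dual BINARY lattices of `(W_i, diag(h)|_{W_i})` (the binary fixed ball of memo §2; its count is A-p12's ★ `SLTwoTree*RamifiedEllipticFixedBall` ∕
`UnitaryTwoRamifiedEllipticFixed*` currency), the equilateral case ★ p847156 being the sub-case where the binary part is again separable.

THE MATHEMATICS (`H = diag(h)`, `|h_l| = 1`; `S = diag(s)`, `|s_l| ≤ 1`, `|s_i − s_j| = 1` for `j ≠ i`).  The Lagrange idempotent `E_i = Π_{j≠i}(S − s_j)∕(s_i − s_j)` is an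
INTEGRAL polynomial in `S` whatever the residues of the `s_j`, `j ≠ i`, are among themselves; so an `S`-stable `M` contains `x_i e_i` and `x − x_i e_i` for each `x ∈ M` (§1).  If `M`
is self-dual: `|x_i|²|h_i| ≤ 1` gives `|x_i| ≤ 1`, hence `pairing(m, e_i) = σ(m_i)h_i ∈ 𝒪` for all `m ∈ M`, i.e. `e_i ∈ M^♯ = M` (§2) — so the `e_i`-component of `M` is EXACTLY `𝒪e_i`
and `M = 𝒪e_i ⊕ (M ∩ W_i)` (§3 `mem_iff_…`).  Finally (§4) for `w ∈ W_i`: `w ∈ M ⟺ ∀ m ∈ M ∩ W_i, |pairing(m, w)| ≤ 1` (⇐: `pairing(m_ie_i + m′, w) = pairing(m′, w)` since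
`pairing(e_i, w) = h_i w_i = 0`), which is self-duality of `M ∩ W_i` INSIDE `W_i`.  HONEST LABEL: HC_CM is proved only modulo the 2 remaining named inputs (hLiu418 24832,
h413 24833) until rung 0 closes; nothing printed is asserted here (elementary lattice algebra over a valuation ring).

## References
* [BruhatTits1972] F. Bruhat, J. Tits, *Groupes réductifs sur un corps local I*, Publ. Math. IHÉS 41 (1972), §10 (lattices adapted to a partial eigen-decomposition).
* [Kottwitz1986] R. E. Kottwitz, *Base change for unit elements of Hecke algebras*, Compositio Math. 60 (1986), §3 (fixed lattices as `𝒪[γ]`-modules; reduction to Levi blocks).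
* [Serre1980Trees] J.-P. Serre, *Trees* (1980), Ch. II §1.1.
-/

set_option autoImplicit false

noncomputable section

open scoped Valued WithZero Matrix MatrixGroups

namespace Literature.NumberTheory.Automorphic.UnitaryLatticeTree

open Literature.NumberTheory.Automorphic Literature.NumberTheory.Automorphic.HermitianLattice

variable {K : Type*} [Field K] [Valued K ℤᵐ⁰]

/-! ## §1 One isolated residue ⇒ coordinate closure at that index -/

/-- **COORDINATE CLOSURE AT AN ISOLATED INDEX** (`N = 3`): if `M` is stable under the integral `diag(s)` and `|s_i − s_j| = 1` for the two `j ≠ i` (no condition between those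
two), then `x_i e_i ∈ M` for every `x ∈ M`. [cite: Kottwitz1986, §3] [cite: BruhatTits1972, §10] -/
theorem single_apply_mem_of_map_diagonal_le_of_isolated {s : Fin 3 → K} (hs : ∀ l, Valued.v (s l) ≤ 1) (i : Fin 3) (hsep : ∀ j, j ≠ i → Valued.v (s i - s j) = 1)
    {M : Submodule 𝒪[K] (Fin 3 → K)} (hSM : M.map ((Matrix.toLin' (Matrix.diagonal s)).restrictScalars 𝒪[K]) ≤ M)
    {x : Fin 3 → K} (hx : x ∈ M) : Pi.single i (x i) ∈ M := by
  obtain ⟨j, j', hj, hj', hjj', hcover⟩ : ∃ j j' : Fin 3, j ≠ i ∧ j' ≠ i ∧ j ≠ j' ∧ ∀ l, l = i ∨ l = j ∨ l = j' := by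
    fin_cases i
    · exact ⟨1, 2, by decide, by decide, by decide, fun l => by fin_cases l <;> decide⟩
    · exact ⟨0, 2, by decide, by decide, by decide, fun l => by fin_cases l <;> decide⟩
    · exact ⟨0, 1, by decide, by decide, by decide, fun l => by fin_cases l <;> decide⟩
  have h1 := smul_sub_mem_of_map_diagonal_le hs hSM (hsep j hj) hx
  have h2 := smul_sub_mem_of_map_diagonal_le hs hSM (hsep j' hj') h1
  convert h2 using 1
  ext l
  have hne : s i - s j ≠ 0 := fun h0 => by have := hsep j hj; rw [h0, map_zero] at this; exact zero_ne_one this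
  have hne' : s i - s j' ≠ 0 := fun h0 => by have := hsep j' hj'; rw [h0, map_zero] at this; exact zero_ne_one this
  rcases hcover l with rfl | rfl | rfl
  · rw [Pi.single_eq_same, inv_mul_cancel₀ hne', one_mul, inv_mul_cancel₀ hne, one_mul]
  · rw [Pi.single_eq_of_ne hj, sub_self, mul_zero, zero_mul, mul_zero]
  · rw [Pi.single_eq_of_ne hj', sub_self, mul_zero, zero_mul]

/-- … and the complementary projection `x − x_i e_i ∈ M ∩ W_i`. [cite: Kottwitz1986, §3] -/
theorem sub_single_apply_mem_of_map_diagonal_le_of_isolated {s : Fin 3 → K} (hs : ∀ l, Valued.v (s l) ≤ 1) (i : Fin 3) (hsep : ∀ j, j ≠ i → Valued.v (s i - s j) = 1)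
    {M : Submodule 𝒪[K] (Fin 3 → K)} (hSM : M.map ((Matrix.toLin' (Matrix.diagonal s)).restrictScalars 𝒪[K]) ≤ M)
    {x : Fin 3 → K} (hx : x ∈ M) : x - Pi.single i (x i) ∈ M ∧ (x - Pi.single i (x i) : Fin 3 → K) i = 0 :=
  ⟨M.sub_mem hx (single_apply_mem_of_map_diagonal_le_of_isolated hs i hsep hSM hx), by simp⟩

/-! ## §2 Self-duality pins the `e_i`-component to `𝒪e_i` -/

omit [Valued K ℤᵐ⁰] in
/-- The diagonal pairing against a coordinate vector: `pairing(diag h)(c·e_i, w) = σ(c)·h_i·w_i`. [cite: BruhatTits1972, §10] -/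
theorem pairing_diagonal_single_left {N : ℕ} (σ : K →+* K) (h : Fin N → K) (i : Fin N) (c : K) (w : Fin N → K) :
    pairing σ (Matrix.diagonal h) (Pi.single i c) w = σ c * h i * w i := by
  rw [pairing_apply, Finset.sum_eq_single i]
  · rw [Finset.sum_eq_single i, Pi.single_eq_same, Matrix.diagonal_apply_eq]
    · intro j _ hj; rw [Matrix.diagonal_apply_ne _ (Ne.symm hj), mul_zero, zero_mul]
    · intro hi; exact absurd (Finset.mem_univ i) hi
  · intro j _ hj; rw [Pi.single_eq_of_ne hj, map_zero]; simp
  · intro hi; exact absurd (Finset.mem_univ i) hi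

/-- For a self-dual `M` (form `diag(h)`, `|h_l| = 1`) stable under an integral `diag(s)` with the `i`-th residue isolated: every `x ∈ M` has `|x_i| ≤ 1`, and `e_i ∈ M`.
[cite: Kottwitz1986, §3] [cite: BruhatTits1972, §10] -/
theorem v_apply_le_one_and_single_mem_of_isolated {σ : K →+* K} (hvσ : ∀ a, Valued.v (σ a) = Valued.v a) {ϖ : K} {h : Fin 3 → K} (hh : ∀ l, Valued.v (h l) = 1)
    {s : Fin 3 → K} (hs : ∀ l, Valued.v (s l) ≤ 1) (i : Fin 3) (hsep : ∀ j, j ≠ i → Valued.v (s i - s j) = 1)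
    {M : Submodule 𝒪[K] (Fin 3 → K)} (hM : IsSelfDualLattice σ ϖ (Matrix.diagonal h) M)
    (hSM : M.map ((Matrix.toLin' (Matrix.diagonal s)).restrictScalars 𝒪[K]) ≤ M) :
    (∀ x ∈ M, Valued.v (x i) ≤ 1) ∧ (Pi.single i (1 : K) : Fin 3 → K) ∈ M := by
  have hne : ∀ l, h l ≠ 0 := fun l h0 => by have := hh l; rw [h0, map_zero] at this; exact zero_ne_one this
  have hHdet : IsUnit (Matrix.diagonal h).det := by
    rw [Matrix.det_diagonal]; exact isUnit_iff_ne_zero.2 (Finset.prod_ne_zero_iff.2 fun l _ => hne l)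
  have hMd : M ≤ dualLatt σ (Matrix.diagonal h) M := le_dualLatt_of_isVertexLattice hvσ hM
  -- `|x_i| ≤ 1`: pair `x_i e_i ∈ M` with itself
  have hcoord : ∀ x ∈ M, Valued.v (x i) ≤ 1 := by
    intro x hx
    have hy := single_apply_mem_of_map_diagonal_le_of_isolated hs i hsep hSM hx
    have hpair := (mem_dualLatt σ _ M _).1 (hMd hy) _ hy
    rw [pairing_diagonal_single_left, Pi.single_eq_same, map_mul, map_mul, hvσ, hh, mul_one] at hpair
    by_contra hgt
    rw [not_le] at hgt
    exact (not_le.2 (one_lt_mul'' hgt hgt)) hpair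
  refine ⟨hcoord, ?_⟩
  -- `e_i ∈ M^♯ = M`
  rw [← dualLatt_eq_self_of_isSelfDualLattice hvσ hHdet hM, mem_dualLatt]
  intro y hy
  -- `pairing(y, e_i) = σ(y_i)·h_i`: swap to the diagonal-single formula via the coordinate sum
  rw [pairing_apply, Finset.sum_eq_single i]
  · rw [Finset.sum_eq_single i, Pi.single_eq_same, Matrix.diagonal_apply_eq, mul_one, map_mul, hvσ, hh, mul_one]
    · exact hcoord y hy
    · intro j _ hj; rw [Pi.single_eq_of_ne hj, mul_zero]
    · intro hi; exact absurd (Finset.mem_univ i) hi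
  · intro j _ hj
    refine Finset.sum_eq_zero fun l _ => ?_
    by_cases hl : l = i
    · subst hl; rw [Matrix.diagonal_apply_ne _ hj, mul_zero, zero_mul]
    · rw [Pi.single_eq_of_ne hl, mul_zero]
  · intro hi; exact absurd (Finset.mem_univ i) hi

/-! ## §3 The splitting `M = 𝒪e_i ⊕ (M ∩ W_i)` -/

/-- **SPLITTING**: under the hypotheses of §2, `x ∈ M ↔ |x_i| ≤ 1 ∧ x − x_i e_i ∈ M` — the `e_i`-component of a root-region vertex is exactly `𝒪e_i` and the rest lies in
`M ∩ W_i`. [cite: Kottwitz1986, §3] [cite: BruhatTits1972, §10] -/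
theorem mem_iff_v_apply_le_one_and_sub_single_mem_of_isolated {σ : K →+* K} (hvσ : ∀ a, Valued.v (σ a) = Valued.v a) {ϖ : K} {h : Fin 3 → K} (hh : ∀ l, Valued.v (h l) = 1)
    {s : Fin 3 → K} (hs : ∀ l, Valued.v (s l) ≤ 1) (i : Fin 3) (hsep : ∀ j, j ≠ i → Valued.v (s i - s j) = 1)
    {M : Submodule 𝒪[K] (Fin 3 → K)} (hM : IsSelfDualLattice σ ϖ (Matrix.diagonal h) M)
    (hSM : M.map ((Matrix.toLin' (Matrix.diagonal s)).restrictScalars 𝒪[K]) ≤ M) (x : Fin 3 → K) :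
    x ∈ M ↔ Valued.v (x i) ≤ 1 ∧ x - Pi.single i (x i) ∈ M := by
  obtain ⟨hcoord, hei⟩ := v_apply_le_one_and_single_mem_of_isolated hvσ hh hs i hsep hM hSM
  constructor
  · exact fun hx => ⟨hcoord x hx, (sub_single_apply_mem_of_map_diagonal_le_of_isolated hs i hsep hSM hx).1⟩
  · rintro ⟨hxi, hw⟩
    have hsingle : Pi.single i (x i) ∈ M := by
      have : (Pi.single i (x i) : Fin 3 → K) = (⟨x i, (mem_integer_iff' _).2 hxi⟩ : 𝒪[K]) • (Pi.single i (1 : K) : Fin 3 → K) := by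
        ext l
        change (Pi.single i (x i) : Fin 3 → K) l = x i * (Pi.single i (1 : K) : Fin 3 → K) l
        by_cases hl : l = i
        · subst hl; simp
        · simp [Pi.single_eq_of_ne hl]
      rw [this]; exact M.smul_mem _ hei
    have := M.add_mem hw hsingle
    rwa [sub_add_cancel] at this

/-! ## §4 The binary part is self-dual RELATIVE to the hyperplane `W_i` -/

/-- **RELATIVE SELF-DUALITY OF THE BINARY PART**: under the hypotheses of §2, for `w` with `w_i = 0`:
`w ∈ M ↔ ∀ m ∈ M, m_i = 0 → |pairing(diag h)(m, w)| ≤ 1` — the lattice `M ∩ W_i` is its own dual inside `W_i` (the `diag(s)`-stable SELF-DUAL BINARY lattice of memo §2: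
`R ≅` binary fixed ball). [cite: Kottwitz1986, §3] [cite: BruhatTits1972, §10] [cite: Serre1980Trees, II.1.1] -/
theorem mem_iff_forall_pairing_le_one_of_isolated {σ : K →+* K} (hvσ : ∀ a, Valued.v (σ a) = Valued.v a) {ϖ : K} {h : Fin 3 → K} (hh : ∀ l, Valued.v (h l) = 1)
    {s : Fin 3 → K} (hs : ∀ l, Valued.v (s l) ≤ 1) (i : Fin 3) (hsep : ∀ j, j ≠ i → Valued.v (s i - s j) = 1)
    {M : Submodule 𝒪[K] (Fin 3 → K)} (hM : IsSelfDualLattice σ ϖ (Matrix.diagonal h) M)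
    (hSM : M.map ((Matrix.toLin' (Matrix.diagonal s)).restrictScalars 𝒪[K]) ≤ M) {w : Fin 3 → K} (hwi : w i = 0) :
    w ∈ M ↔ ∀ m ∈ M, m i = 0 → Valued.v (pairing σ (Matrix.diagonal h) m w) ≤ 1 := by
  have hne : ∀ l, h l ≠ 0 := fun l h0 => by have := hh l; rw [h0, map_zero] at this; exact zero_ne_one this
  have hHdet : IsUnit (Matrix.diagonal h).det := by
    rw [Matrix.det_diagonal]; exact isUnit_iff_ne_zero.2 (Finset.prod_ne_zero_iff.2 fun l _ => hne l)
  have hMd : M ≤ dualLatt σ (Matrix.diagonal h) M := le_dualLatt_of_isVertexLattice hvσ hM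
  constructor
  · intro hw m hm _
    exact (mem_dualLatt σ _ M _).1 (hMd hw) m hm
  · intro hdual
    rw [← dualLatt_eq_self_of_isSelfDualLattice hvσ hHdet hM, mem_dualLatt]
    intro m hm
    -- split `m = m_i e_i + m′`, `m′ ∈ M ∩ W_i`; the `e_i`-part pairs to zero with `w`
    obtain ⟨hm', hm'i⟩ := sub_single_apply_mem_of_map_diagonal_le_of_isolated hs i hsep hSM hm
    have hsplit : pairing σ (Matrix.diagonal h) m w = pairing σ (Matrix.diagonal h) (m - Pi.single i (m i)) w := by
      have e : m = (m - Pi.single i (m i)) + Pi.single i (m i) := (sub_add_cancel _ _).symm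
      conv_lhs => rw [e]
      rw [LinearMap.map_add₂, pairing_diagonal_single_left, hwi, mul_zero, add_zero]
    rw [hsplit]
    exact hdual _ hm' hm'i

end Literature.NumberTheory.Automorphic.UnitaryLatticeTree

end
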